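import Literature.Analysis.Hypoelliptic.ShadowConv
import Literature.Analysis.Hypoelliptic.Bootstrap
import HarnessLib

/-!
# The dictionary, III: sums, scalars, flat fields and the Hörmander operator

Analysis/Hypoelliptic support file serving the discharge of
`Literature.Analysis.Distribution.Hormander1967_thm11`, continuing `ShadowConv.lean`.

* `Rep` is stable under scalars and finite sums (`Rep.const_mul`, `Rep.plus`, `Rep.finset_sum`).
* **Shadow of a flat field** (`Rep.flatField`): if the coefficients of the flat field `F`
  (`c_k + θ_k`, `θ_k = θ_{b_k}`) come from real functions `c_k + a_k` on `E` (`a_k ∘ T⁻¹ = b_k`),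
  and `H` represents `R`, then `F.applyF H` represents `R ∘ D`, where
  `D h = ∑_k ∂_{v_k}((c_k + a_k) h)` (`v_k = T⁻¹ b_k`) — minus the formal transpose of the vector
  field `∑_k (c_k + a_k) ∂_{v_k}`, complexified (`fieldC`).
* **Shadow of the operator** (`Rep.Pf`): `Pf H` represents `R ∘ (∑_j D_j D_j + D₀ + (c + a_C))`.

## References

* L. Hörmander, *The Analysis of Linear Partial Differential Operators I*, §7.1 (folklore).
-/

noncomputable section

open MeasureTheory Set Filter Function SchwartzMap TopologicalSpace Distributions TestFunction
open scoped ENNReal NNReal Topology ComplexConjugate InnerProductSpace FourierTransform BigOperators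
  ContDiff

namespace Literature.Analysis.Hypoelliptic

variable {V : Type*} [NormedAddCommGroup V] [InnerProductSpace ℝ V] [FiniteDimensional ℝ V]
  [MeasurableSpace V] [BorelSpace V]
variable {E : Type*} [NormedAddCommGroup E] [NormedSpace ℝ E] {Ω : Opens E}
variable {u : 𝓓'(Ω, ℝ)} {ζ : 𝓓(Ω, ℝ)} {T : E →L[ℝ] V}

/-! ### Scalars and sums -/

/-- Scalars. [folklore] -/
theorem Rep.const_mul {H : V → ℂ} {R : (E → ℂ) → (E → ℂ)} (hR : Rep u ζ T H R) (c : ℂ) :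
    Rep u ζ T (fun ξ => c * H ξ) (fun h => R (fun x => c * h x)) := by
  obtain ⟨t, ht⟩ := hR.inH
  refine ⟨⟨t, ht.const_mul c⟩, fun h hh => hR.smooth _ (contDiff_const.mul hh), fun h g hh hg => ?_,
    fun c' h hh => ?_, fun ψ => ?_⟩
  · have e : (fun x => c * (h x + g x)) = fun x => c * h x + c * g x := by ext; ring
    rw [e, hR.add _ _ (contDiff_const.mul hh) (contDiff_const.mul hg)]
  · have e : (fun x => c * (c' * h x)) = fun x => c' * (c * h x) := by ext; ring
    rw [e, hR.hom c' _ (contDiff_const.mul hh)]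
  · rw [pairing_const_mul_left, hR.eq ψ, hR.hom c _ (contDiff_conj_fourier_comp T ψ),
      uC_const_mul u ζ c (hR.smooth _ (contDiff_conj_fourier_comp T ψ))]

/-- Sums. [folklore] -/
theorem Rep.plus {H₁ H₂ : V → ℂ} {R₁ R₂ : (E → ℂ) → (E → ℂ)} (h₁ : Rep u ζ T H₁ R₁) (h₂ : Rep u ζ T H₂ R₂) :
    Rep u ζ T (fun ξ => H₁ ξ + H₂ ξ) (fun h x => R₁ h x + R₂ h x) := by
  obtain ⟨t₁, ht₁⟩ := h₁.inH
  obtain ⟨t₂, ht₂⟩ := h₂.inH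
  have i₁ := ht₁.mono (min_le_left t₁ t₂)
  have i₂ := ht₂.mono (min_le_right t₁ t₂)
  refine ⟨⟨min t₁ t₂, i₁.add i₂⟩, fun h hh => (h₁.smooth h hh).add (h₂.smooth h hh), fun h g hh hg => ?_,
    fun c h hh => ?_, fun ψ => ?_⟩
  · ext x
    rw [h₁.add h g hh hg, h₂.add h g hh hg]
    simp only; ring
  · ext x
    rw [h₁.hom c h hh, h₂.hom c h hh]
    simp only; ring
  · have hψ := SchwartzMap.nice ψ
    rw [pairing_add_left i₁ i₂ (hψ.inH _), h₁.eq ψ, h₂.eq ψ,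
      ← uC_add u ζ (h₁.smooth _ (contDiff_conj_fourier_comp T ψ)) (h₂.smooth _ (contDiff_conj_fourier_comp T ψ))]

/-- The zero function represents the zero operator. [folklore] -/
theorem Rep.zero (u : 𝓓'(Ω, ℝ)) (ζ : 𝓓(Ω, ℝ)) (T : E →L[ℝ] V) :
    Rep u ζ T (fun _ => 0) (fun _ _ => 0) := by
  refine ⟨⟨0, ?_⟩, fun h _ => contDiff_const, fun h g _ _ => by ext; simp, fun c h _ => by ext; simp, fun ψ => ?_⟩
  · exact ⟨aestronglyMeasurable_const, by simp [wnorm]⟩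
  · have h0 : uC u ζ (fun _ : E => (0 : ℂ)) = 0 := by
      have := uC_const_mul u ζ 0 (h := fun _ : E => (0 : ℂ)) contDiff_const
      simp only [zero_mul] at this
      exact this
    rw [h0]
    simp [pairing]

/-- Finite sums. [folklore] -/
theorem Rep.finset_sum {ι : Type*} (S : Finset ι) {H : ι → V → ℂ} {R : ι → (E → ℂ) → (E → ℂ)}
    (h : ∀ i, Rep u ζ T (H i) (R i)) :
    Rep u ζ T (fun ξ => ∑ i ∈ S, H i ξ) (fun g x => ∑ i ∈ S, R i g x) := by
  classical
  induction S using Finset.induction_on with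
  | empty => simpa using Rep.zero u ζ T
  | insert a S ha ih =>
    have := (h a).plus ih
    simp only [Finset.sum_insert ha]
    exact this

/-! ### Changing the operator on smooth functions -/

/-- If `H` represents `R₁` and `R₁ = R₂` on smooth functions then `H` represents `R₂`. [folklore] -/
theorem Rep.congr {T : E →L[ℝ] V} {H : V → ℂ} {R₁ R₂ : (E → ℂ) → (E → ℂ)} (hR : Rep u ζ T H R₁)
    (e : ∀ h, ContDiff ℝ ∞ h → R₁ h = R₂ h) : Rep u ζ T H R₂ := by
  refine ⟨hR.inH, fun h hh => (e h hh) ▸ hR.smooth h hh, fun h g hh hg => ?_, fun c h hh => ?_, fun ψ => ?_⟩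
  · rw [← e _ (hh.add hg), ← e _ hh, ← e _ hg, hR.add h g hh hg]
  · rw [← e _ (contDiff_const.mul hh), ← e _ hh, hR.hom c h hh]
  · rw [hR.eq ψ, e _ (contDiff_conj_fourier_comp T ψ)]

/-- A represented operator is additive over finite sums of smooth functions. [folklore] -/
theorem Rep.map_sum {T : E →L[ℝ] V} {H : V → ℂ} {R : (E → ℂ) → (E → ℂ)} (hR : Rep u ζ T H R)
    {κ : Type*} (S : Finset κ) (g : κ → E → ℂ) (hg : ∀ i, ContDiff ℝ ∞ (g i)) :
    R (fun x => ∑ i ∈ S, g i x) = fun x => ∑ i ∈ S, R (g i) x := by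
  classical
  induction S using Finset.induction_on with
  | empty =>
    simp only [Finset.sum_empty]
    have := hR.hom 0 (fun _ => (0 : ℂ)) contDiff_const
    simpa using this
  | insert a S ha ih =>
    simp only [Finset.sum_insert ha]
    rw [hR.add _ _ (hg a) (ContDiff.sum fun i _ => hg i), ih]

/-! ### Flat fields -/

/-- The complexified first-order operator `h ↦ ∑_k ∂_{v_k} (xa_k · h)` (minus the formal
transpose of `∑_k xa_k ∂_{v_k}`). [folklore] -/
def fieldC {ι : Type*} [Fintype ι] (xa : ι → E → ℝ) (v : ι → E) (h : E → ℂ) : E → ℂ :=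
  fun x => ∑ k, derivC (v k) (mulC (xa k) h) x

/-- `fieldC` preserves smoothness. [folklore] -/
theorem contDiff_fieldC {ι : Type*} [Fintype ι] {xa : ι → E → ℝ} (hxa : ∀ k, ContDiff ℝ ∞ (xa k))
    (v : ι → E) {h : E → ℂ} (hh : ContDiff ℝ ∞ h) : ContDiff ℝ ∞ (fieldC xa v h) := by
  unfold fieldC
  exact ContDiff.sum fun k _ => contDiff_derivC _ (contDiff_mulC (hxa k) hh)

/-- **Link of a flat field to `x`-side data**: the Fourier-side coefficients `c_k + conv θ_k`
come from real functions `c_k + a_k` with `θ_k = θ_{b_k}`, `a_k = b_k ∘ T`; the directions are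
`v_k = T⁻¹ (b k)`. [folklore] -/
structure FlatField.XData {ι : Type*} [Fintype ι] (F : FlatField V ι) (bV : ι → V)
    (T : E ≃L[ℝ] V) where
  /-- the variable parts of the coefficients, on `E` [folklore] -/
  a : ι → E → ℝ
  /-- their Schwartz avatars on `V` [folklore] -/
  b : ι → 𝓢(V, ℂ)
  smooth : ∀ k, ContDiff ℝ ∞ (a k)
  link : ∀ k x, (a k x : ℂ) = b k (T x)
  theta : ∀ k, F.θ k = thetaOf (b k)
  creal : ∀ k, (F.c k).im = 0

/-- The frame directions `v_k = T⁻¹ (bV k)` on `E`. [folklore] -/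
def frameDir {ι : Type*} (T : E ≃L[ℝ] V) (bV : ι → V) (k : ι) : E := T.symm (bV k)

namespace FlatField.XData

variable {ι : Type*} [Fintype ι] {F : FlatField V ι} {bV : ι → V} {T : E ≃L[ℝ] V}
  (xd : F.XData bV T)

/-- The full real coefficient `c_k + a_k`. [folklore] -/
def xa (k : ι) : E → ℝ := fun x => (F.c k).re + xd.a k x

/-- Smoothness of the full coefficients. [folklore] -/
theorem contDiff_xa (k : ι) : ContDiff ℝ ∞ (xd.xa k) := contDiff_const.add (xd.smooth k)

end FlatField.XData

/-- **Shadow of a flat field**: if `H` represents `R` then `F.applyF H` represents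
`R ∘ fieldC (c + a) v`. [folklore] -/
theorem Rep.flatField {ι : Type*} [Fintype ι] {F : FlatField V ι} {bV : ι → V} {T : E ≃L[ℝ] V}
    (xd : F.XData bV T) {H : V → ℂ} {R : (E → ℂ) → (E → ℂ)} (hR : Rep u ζ (T : E →L[ℝ] V) H R) :
    Rep u ζ (T : E →L[ℝ] V) (F.applyF bV H) (fun h => R (fieldC xd.xa (frameDir T bV) h)) := by
  -- each term `c_k L_k H + conv θ_k (L_k H)` represents `R ∘ ∂_{v_k} ∘ ((c_k + a_k) ·)`
  have hterm : ∀ k, Rep u ζ (T : E →L[ℝ] V)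
      (fun ξ => F.c k * FlatField.L bV k H ξ + kerOp (convKer (F.θ k)) (FlatField.L bV k H) ξ)
      (fun h x => R (derivC ((frameDir T bV) k) (fun y => (F.c k : ℂ) * h y)) x +
        R (derivC ((frameDir T bV) k) (mulC (xd.a k) h)) x) := by
    intro k
    have hL : Rep u ζ (T : E →L[ℝ] V) (FlatField.L bV k H) (fun h => R (derivC ((frameDir T bV) k) h)) := hR.mulLin (bV k)
    have h1 := hL.const_mul (F.c k)
    have h2 := hL.conv (xd.smooth k) (b := xd.b k) (xd.link k)
    rw [← xd.theta k] at h2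
    exact h1.plus h2
  have hsum := Rep.finset_sum Finset.univ hterm
  -- `R` is additive over finite sums
  have Rsum : ∀ {κ : Type _} (S' : Finset κ) (g : κ → E → ℂ), (∀ i, ContDiff ℝ ∞ (g i)) →
      R (fun x => ∑ i ∈ S', g i x) = fun x => ∑ i ∈ S', R (g i) x := by
    intro κ S' g hg
    classical
    induction S' using Finset.induction_on with
    | empty =>
      simp only [Finset.sum_empty]
      have := hR.hom 0 (fun _ => (0 : ℂ)) contDiff_const
      simpa using this
    | insert a S' ha ih =>
      simp only [Finset.sum_insert ha]
      rw [hR.add _ _ (hg a) (ContDiff.sum fun i _ => hg i), ih]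
  -- the operator identity: `∑_k (R ∂(c h) + R ∂(a h)) = R (fieldC xa v h)`
  have hop : ∀ h : E → ℂ, ContDiff ℝ ∞ h →
      (fun x => ∑ k ∈ Finset.univ, (R (derivC ((frameDir T bV) k) (fun y => (F.c k : ℂ) * h y)) x +
        R (derivC ((frameDir T bV) k) (mulC (xd.a k) h)) x)) = R (fieldC xd.xa (frameDir T bV) h) := by
    intro h hh
    have hck : ∀ k, ContDiff ℝ ∞ (fun y => (F.c k : ℂ) * h y) := fun k => contDiff_const.mul hh
    have hak : ∀ k, ContDiff ℝ ∞ (mulC (xd.a k) h) := fun k => contDiff_mulC (xd.smooth k) hh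
    -- termwise: `∂((c + a) h) = ∂(c h) + ∂(a h)` and `R` additive
    have e1 : ∀ k, derivC ((frameDir T bV) k) (mulC (xd.xa k) h) = fun x =>
        derivC ((frameDir T bV) k) (fun y => (F.c k : ℂ) * h y) x + derivC ((frameDir T bV) k) (mulC (xd.a k) h) x := by
      intro k
      ext x
      unfold derivC
      have e : mulC (xd.xa k) h = fun y => (F.c k : ℂ) * h y + mulC (xd.a k) h y := by
        ext y
        simp only [mulC, FlatField.XData.xa]
        push_cast
        have hc : (F.c k : ℂ) = ((F.c k).re : ℂ) := by
          apply Complex.ext <;> simp [xd.creal k]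
        rw [← hc]; ring
      rw [e, fderiv_fun_add ((hck k).differentiable (by simp)).differentiableAt
        ((hak k).differentiable (by simp)).differentiableAt]
      simp
    unfold fieldC
    rw [Rsum Finset.univ _ (fun k => contDiff_derivC _ (contDiff_mulC (xd.contDiff_xa k) hh))]
    ext x
    refine Finset.sum_congr rfl fun k _ => ?_
    rw [e1 k, hR.add _ _ (contDiff_derivC _ (hck k)) (contDiff_derivC _ (hak k))]
  refine ⟨hsum.inH, fun h hh => hR.smooth _ (contDiff_fieldC xd.contDiff_xa _ hh), fun h g hh hg => ?_,
    fun c h hh => ?_, fun ψ => ?_⟩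
  · rw [← hop _ (hh.add hg), ← hop _ hh, ← hop _ hg, hsum.add h g hh hg]
  · rw [← hop _ (contDiff_const.mul hh), ← hop _ hh, hsum.hom c h hh]
  · rw [show F.applyF bV H = fun ξ => ∑ k ∈ Finset.univ,
        (F.c k * FlatField.L bV k H ξ + kerOp (convKer (F.θ k)) (FlatField.L bV k H) ξ) from rfl, hsum.eq ψ,
      hop _ (contDiff_conj_fourier_comp _ ψ)]

/-! ### The Hörmander operator -/

namespace FlatHData

variable {J : ℕ}

/-- **Link of a flat Hörmander operator to `x`-side data**: `x`-side data for every field and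
for the zeroth-order coefficient. [folklore] -/
structure XLink (fd : FlatHData V J) (T : E ≃L[ℝ] V) where
  /-- data of the fields `X_j` [folklore] -/
  xX : ∀ j, (fd.X j).XData FlatHData.bas T
  /-- data of the drift `X₀` [folklore] -/
  xX0 : fd.X0.XData FlatHData.bas T
  /-- variable part of `c` on `E` [folklore] -/
  aC : E → ℝ
  /-- its Schwartz avatar [folklore] -/
  bC : 𝓢(V, ℂ)
  smoothC : ContDiff ℝ ∞ aC
  linkC : ∀ x, (aC x : ℂ) = bC (T x)
  thetaC : fd.θC = thetaOf bC
  crealC : fd.cC.im = 0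

namespace XLink

variable {fd : FlatHData V J} {T : E ≃L[ℝ] V} (xl : fd.XLink T)

/-- The `x`-side first-order operator of `X_j` (minus a formal transpose, complexified). [folklore] -/
def D (j : Fin J) : (E → ℂ) → (E → ℂ) := fieldC (xl.xX j).xa (frameDir T FlatHData.bas)

/-- The `x`-side first-order operator of `X₀`. [folklore] -/
def D0 : (E → ℂ) → (E → ℂ) := fieldC xl.xX0.xa (frameDir T FlatHData.bas)

/-- The full zeroth-order coefficient `c + a_C`. [folklore] -/
def cfull : E → ℝ := fun x => fd.cC.re + xl.aC x

/-- **The `x`-side operator represented by `Pf`**: `h ↦ ∑_j D_j (D_j h) + D₀ h + (c + a_C) h`.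
[folklore] -/
def PfC (h : E → ℂ) : E → ℂ :=
  fun x => (∑ j, xl.D j (xl.D j h) x) + xl.D0 h x + (xl.cfull x : ℂ) * h x

/-- Smoothness of `D_j`. [folklore] -/
theorem contDiff_D (j : Fin J) {h : E → ℂ} (hh : ContDiff ℝ ∞ h) : ContDiff ℝ ∞ (xl.D j h) :=
  contDiff_fieldC (xl.xX j).contDiff_xa _ hh

/-- Smoothness of `D₀`. [folklore] -/
theorem contDiff_D0 {h : E → ℂ} (hh : ContDiff ℝ ∞ h) : ContDiff ℝ ∞ (xl.D0 h) :=
  contDiff_fieldC xl.xX0.contDiff_xa _ hh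

/-- Smoothness of the full coefficient. [folklore] -/
theorem contDiff_cfull : ContDiff ℝ ∞ xl.cfull := contDiff_const.add xl.smoothC

/-- Smoothness of `PfC`. [folklore] -/
theorem contDiff_PfC {h : E → ℂ} (hh : ContDiff ℝ ∞ h) : ContDiff ℝ ∞ (xl.PfC h) := by
  unfold PfC
  refine ((ContDiff.sum fun j _ => xl.contDiff_D j (xl.contDiff_D j hh)).add (xl.contDiff_D0 hh)).add ?_
  exact (Complex.ofRealCLM.contDiff.comp xl.contDiff_cfull).mul hh

end XLink

end FlatHData

/-- **Shadow of the Hörmander operator**: if `H` represents `R` then `Pf H` represents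
`R ∘ PfC`. [folklore] -/
theorem Rep.Pf {J : ℕ} {fd : FlatHData V J} {T : E ≃L[ℝ] V} (xl : fd.XLink T)
    {H : V → ℂ} {R : (E → ℂ) → (E → ℂ)} (hR : Rep u ζ (T : E →L[ℝ] V) H R) :
    Rep u ζ (T : E →L[ℝ] V) (fd.Pf H) (fun h => R (xl.PfC h)) := by
  -- the pieces
  have hXX : ∀ j, Rep u ζ (T : E →L[ℝ] V) (fd.Xf j (fd.Xf j H)) (fun h => R (xl.D j (xl.D j h))) :=
    fun j => (hR.flatField (xl.xX j)).flatField (xl.xX j)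
  have hX0 : Rep u ζ (T : E →L[ℝ] V) (fd.X0f H) (fun h => R (xl.D0 h)) := hR.flatField xl.xX0
  have hC : Rep u ζ (T : E →L[ℝ] V) (fd.Cf H) (fun h x => R (fun y => fd.cC * h y) x + R (mulC xl.aC h) x) := by
    have h1 := hR.const_mul fd.cC
    have h2 := hR.conv xl.smoothC (b := xl.bC) xl.linkC
    rw [← xl.thetaC] at h2
    exact h1.plus h2
  have hsum := ((Rep.finset_sum Finset.univ hXX).plus hX0).plus hC
  refine hsum.congr fun h hh => ?_
  -- identify the operators using additivity of `R`
  have hDD : ∀ j, ContDiff ℝ ∞ (xl.D j (xl.D j h)) := fun j => xl.contDiff_D j (xl.contDiff_D j hh)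
  have hc1 : ContDiff ℝ ∞ (fun y => fd.cC * h y) := contDiff_const.mul hh
  have hc2 : ContDiff ℝ ∞ (mulC xl.aC h) := contDiff_mulC xl.smoothC hh
  have ecf : ∀ x, (xl.cfull x : ℂ) * h x = fd.cC * h x + mulC xl.aC h x := by
    intro x
    simp only [FlatHData.XLink.cfull, mulC]
    have hc : (fd.cC : ℂ) = ((fd.cC).re : ℂ) := by apply Complex.ext <;> simp [xl.crealC]
    push_cast
    rw [← hc]; ring
  have e2 : xl.PfC h = fun x => ((∑ j ∈ Finset.univ, xl.D j (xl.D j h) x) + xl.D0 h x) +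
      ((fun y => fd.cC * h y) x + mulC xl.aC h x) := by
    ext x
    simp only [FlatHData.XLink.PfC]
    rw [ecf x]
  show (fun x => (∑ j ∈ Finset.univ, R (xl.D j (xl.D j h)) x + R (xl.D0 h) x) +
      (R (fun y => fd.cC * h y) x + R (mulC xl.aC h) x)) = R (xl.PfC h)
  rw [e2, hR.add _ _ ((ContDiff.sum fun j _ => hDD j).add (xl.contDiff_D0 hh)) (hc1.add hc2),
    hR.add _ _ (ContDiff.sum fun j _ => hDD j) (xl.contDiff_D0 hh), hR.add _ _ hc1 hc2,
    hR.map_sum Finset.univ _ hDD]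

end Literature.Analysis.Hypoelliptic
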